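import Summits.AtomisticToContinuum.Crystallization.Theorems.FrustratedLawDichotomyStrainedPatchHomValueT2SlopeSoundB
import Summits.AtomisticToContinuum.Crystallization.Theorems.FrustratedLawDichotomyStrainedPatchHomValueT2SlopeSoundJ
import Summits.AtomisticToContinuum.Crystallization.Theorems.FrustratedLawDichotomyStrainedPatchHomValueT2SoundW

/-!
# (I1) slope part L — the label sums of the junction-class and Lipschitz-class CHARGES against the slope fold's integer entries `hp`, `rp`
# (`…HomValueT2Track` §14b; critic row 1674 (B) (I1) docket item 3 `slopeT2_sound`, twelfth instalment; 27623 `(H) HomFloor`; decomp-a2c hand-1 g49)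

Given the two record families of the labels of `nearB c w'` (`w' = trackW aP w`) and the slope fold of `t2SlopeT2` (part K's expression):
`slope_hp_bound`: `Σ_{b ¬lip} Σ_e |jF aP Rb_b a e|↑/SC·|δ_e| ≤ hp_a/SC²`;  `slope_rp_bound`: `Σ_{b lip} ½ΣΣ|ddF|↑/SC·|δ||δ| ≤ rp_a/(2SC²) + 81·#LB/(2SC)`
(`|δ_k| ≤ wf_k/SC`, parts B, I, J).  No definitions; 0 sorry; standard axioms.  `--supports stmt-AtomisticToContinuum-27623`.
-/

noncomputable section

namespace Summit.AtomisticToContinuum.Crystallization.Theorems.FrustratedLawDichotomyStrainedPatchHomValueT2Kit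

open scoped BigOperators RealInnerProductSpace
open Finset
open Literature.Analysis.ValidatedNumerics.Numerics
open Summit.AtomisticToContinuum.Crystallization.Theorems.ChargedEnergyGapNegative (E3)
open Summit.AtomisticToContinuum.Crystallization.Theorems.FrustratedLawDichotomyStrainedPatchHomEntryGramHcp (shufFI)
open Summit.AtomisticToContinuum.Crystallization.Theorems.FrustratedLawDichotomyStrainedPatchHomCurvCentreKit (boxE cenE cenX cenMap cenShuf)

/-- ★ **JUNCTION-CLASS CHARGES AGAINST `hp`.** [formal bookkeeping: `foldl_slope_spec` + `hp_charge_le`] -/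
theorem slope_hp_bound {c w : (Fin 3 × Fin 3) ⊕ Fin 3 → ℤ} {aP : Fin 3 → Fin 6 → ℤ} (hflag : ((nearB c (trackW aP w)).foldl (fun A b =>
        match mkDRec 9 (cenE c) (qB (cenX c) b), mkDRec 9 (boxE c (trackW aP w)) (qB (shufFI c (trackW aP w)) b) with
        | some Rp, some Rb => accSlope aP (Array.ofFn fun p : Fin 9 => foldW (trackW aP w) p) Rp Rb A
        | _, _ => (⟨false, A.fc, A.jc, A.hp, A.rp⟩ : AccS)) (⟨true, zeroArr 3, zeroArr 18, Array.replicate 3 0, Array.replicate 3 0⟩ : AccS)).ok = true)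
    {RpB RbB : (Fin 3 → ℤ) → DRec}
    (hRpB : ∀ b ∈ (nearB c (trackW aP w)), mkDRec 9 (cenE c) (qB (cenX c) b) = some (RpB b)) (hRbB : ∀ b ∈ (nearB c (trackW aP w)), mkDRec 9 (boxE c (trackW aP w)) (qB (shufFI c (trackW aP w)) b) = some (RbB b))
    (U : E3 →L[ℝ] E3) (ξ : E3) (hδ : ∀ k, k < 9 → |dispN (U - cenMap c) (ξ - cenShuf c) k| ≤ (((Array.ofFn fun p : Fin 9 => foldW (trackW aP w) p).getD k 0 : ℤ) : ℝ) / SC) (a : Fin 3) :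
    ∑ b ∈ (nearB c (trackW aP w)).toFinset, (if (RbB b).co.lip then 0 else ∑ e ∈ range 6, (((jF aP (RbB b) a e).absHi : ℤ) : ℝ) / SC * |dispN (U - cenMap c) (ξ - cenShuf c) e|) ≤ ((((nearB c (trackW aP w)).foldl (fun A b =>
        match mkDRec 9 (cenE c) (qB (cenX c) b), mkDRec 9 (boxE c (trackW aP w)) (qB (shufFI c (trackW aP w)) b) with
        | some Rp, some Rb => accSlope aP (Array.ofFn fun p : Fin 9 => foldW (trackW aP w) p) Rp Rb A
        | _, _ => (⟨false, A.fc, A.jc, A.hp, A.rp⟩ : AccS)) (⟨true, zeroArr 3, zeroArr 18, Array.replicate 3 0, Array.replicate 3 0⟩ : AccS)).hp.getD a.val 0 : ℤ) : ℝ) / ((SC : ℝ) * SC) := by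
  classical
  have hS := SC_pos
  obtain ⟨_, _, _, _, hhp, _⟩ := foldl_slope_spec aP (Array.ofFn fun p : Fin 9 => foldW (trackW aP w) p) (nearB c (trackW aP w)) (fun b => mkDRec 9 (cenE c) (qB (cenX c) b)) (fun b => mkDRec 9 (boxE c (trackW aP w)) (qB (shufFI c (trackW aP w)) b))
    (⟨true, zeroArr 3, zeroArr 18, Array.replicate 3 0, Array.replicate 3 0⟩ : AccS) hflag
  have e0 : ((Array.replicate 3 (0 : ℤ)).getD a.val 0) = 0 := by
    rw [Array.getD_eq_getD_getElem?, Array.getElem?_replicate, if_pos a.isLt, Option.getD_some]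
  have ehp : ((nearB c (trackW aP w)).foldl (fun A b =>
        match mkDRec 9 (cenE c) (qB (cenX c) b), mkDRec 9 (boxE c (trackW aP w)) (qB (shufFI c (trackW aP w)) b) with
        | some Rp, some Rb => accSlope aP (Array.ofFn fun p : Fin 9 => foldW (trackW aP w) p) Rp Rb A
        | _, _ => (⟨false, A.fc, A.jc, A.hp, A.rp⟩ : AccS)) (⟨true, zeroArr 3, zeroArr 18, Array.replicate 3 0, Array.replicate 3 0⟩ : AccS)).hp.getD a.val 0 = ∑ b ∈ (nearB c (trackW aP w)).toFinset, (if (RbB b).co.lip then 0 else (List.range 6).foldl (fun s e => s + (jF aP (RbB b) a e).absHi * (Array.ofFn fun p : Fin 9 => foldW (trackW aP w) p).getD e 0) 0) := by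
    refine (hhp a.val a.isLt).trans ?_
    rw [← List.sum_toFinset _ (nearB_nodup c (trackW aP w))]
    simp only [e0, zero_add]
    refine Finset.sum_congr rfl fun b hb => ?_
    have hb' := List.mem_toFinset.1 hb
    simp only [hRpB b hb', hRbB b hb']
  rw [ehp]; push_cast
  rw [Finset.sum_div]
  refine Finset.sum_le_sum fun b hb => ?_
  split_ifs with hl
  · simp
  · exact hp_charge_le aP (RbB b) a (Array.ofFn fun p : Fin 9 => foldW (trackW aP w) p) (dispN (U - cenMap c) (ξ - cenShuf c)) (fun e he => hδ e (by omega))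

/-- ★ **LIPSCHITZ-CLASS CHARGES AGAINST `rp`** (with the inner-floor correction `81/(2SC)` per label). [formal bookkeeping: `foldl_slope_spec` + `rp_charge_le`] -/
theorem slope_rp_bound {c w : (Fin 3 × Fin 3) ⊕ Fin 3 → ℤ} {aP : Fin 3 → Fin 6 → ℤ} (hflag : ((nearB c (trackW aP w)).foldl (fun A b =>
        match mkDRec 9 (cenE c) (qB (cenX c) b), mkDRec 9 (boxE c (trackW aP w)) (qB (shufFI c (trackW aP w)) b) with
        | some Rp, some Rb => accSlope aP (Array.ofFn fun p : Fin 9 => foldW (trackW aP w) p) Rp Rb A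
        | _, _ => (⟨false, A.fc, A.jc, A.hp, A.rp⟩ : AccS)) (⟨true, zeroArr 3, zeroArr 18, Array.replicate 3 0, Array.replicate 3 0⟩ : AccS)).ok = true)
    (hwpos : ∀ p : Fin 9, 0 < foldW (trackW aP w) p) (hw1 : ∀ p : Fin 9, foldW (trackW aP w) p ≤ (SC : ℤ)) {RpB RbB : (Fin 3 → ℤ) → DRec}
    (hRpB : ∀ b ∈ (nearB c (trackW aP w)), mkDRec 9 (cenE c) (qB (cenX c) b) = some (RpB b)) (hRbB : ∀ b ∈ (nearB c (trackW aP w)), mkDRec 9 (boxE c (trackW aP w)) (qB (shufFI c (trackW aP w)) b) = some (RbB b))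
    (U : E3 →L[ℝ] E3) (ξ : E3) (hδ : ∀ k, k < 9 → |dispN (U - cenMap c) (ξ - cenShuf c) k| ≤ (((Array.ofFn fun p : Fin 9 => foldW (trackW aP w) p).getD k 0 : ℤ) : ℝ) / SC) (a : Fin 3) :
    ∑ b ∈ (nearB c (trackW aP w)).toFinset, (if (RbB b).co.lip then 1 / 2 * ∑ k ∈ range 9, ∑ l ∈ range 9, (((ddF (RbB b) a k l).absHi : ℤ) : ℝ) / SC * (|dispN (U - cenMap c) (ξ - cenShuf c) k| * |dispN (U - cenMap c) (ξ - cenShuf c) l|) else 0) ≤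
      ((((nearB c (trackW aP w)).foldl (fun A b =>
        match mkDRec 9 (cenE c) (qB (cenX c) b), mkDRec 9 (boxE c (trackW aP w)) (qB (shufFI c (trackW aP w)) b) with
        | some Rp, some Rb => accSlope aP (Array.ofFn fun p : Fin 9 => foldW (trackW aP w) p) Rp Rb A
        | _, _ => (⟨false, A.fc, A.jc, A.hp, A.rp⟩ : AccS)) (⟨true, zeroArr 3, zeroArr 18, Array.replicate 3 0, Array.replicate 3 0⟩ : AccS)).rp.getD a.val 0 : ℤ) : ℝ) / (2 * (SC : ℝ) * SC) + 81 * ((nearB c (trackW aP w)).length : ℝ) / (2 * (SC : ℝ)) := by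
  classical
  have hS := SC_pos
  have hwf0 : ∀ k, 0 ≤ (Array.ofFn fun p : Fin 9 => foldW (trackW aP w) p).getD k 0 := wfA_nonneg hwpos
  have hwf1 : ∀ k, (Array.ofFn fun p : Fin 9 => foldW (trackW aP w) p).getD k 0 ≤ (SC : ℤ) := wfA_le (by positivity) hw1
  obtain ⟨_, _, _, _, _, hrp⟩ := foldl_slope_spec aP (Array.ofFn fun p : Fin 9 => foldW (trackW aP w) p) (nearB c (trackW aP w)) (fun b => mkDRec 9 (cenE c) (qB (cenX c) b)) (fun b => mkDRec 9 (boxE c (trackW aP w)) (qB (shufFI c (trackW aP w)) b))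
    (⟨true, zeroArr 3, zeroArr 18, Array.replicate 3 0, Array.replicate 3 0⟩ : AccS) hflag
  have e0 : ((Array.replicate 3 (0 : ℤ)).getD a.val 0) = 0 := by
    rw [Array.getD_eq_getD_getElem?, Array.getElem?_replicate, if_pos a.isLt, Option.getD_some]
  have erp : ((nearB c (trackW aP w)).foldl (fun A b =>
        match mkDRec 9 (cenE c) (qB (cenX c) b), mkDRec 9 (boxE c (trackW aP w)) (qB (shufFI c (trackW aP w)) b) with
        | some Rp, some Rb => accSlope aP (Array.ofFn fun p : Fin 9 => foldW (trackW aP w) p) Rp Rb A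
        | _, _ => (⟨false, A.fc, A.jc, A.hp, A.rp⟩ : AccS)) (⟨true, zeroArr 3, zeroArr 18, Array.replicate 3 0, Array.replicate 3 0⟩ : AccS)).rp.getD a.val 0 = ∑ b ∈ (nearB c (trackW aP w)).toFinset, (if (RbB b).co.lip then (List.range 9).foldl (fun s k => (List.range 9).foldl (fun s2 l => if l < k then s2 else s2 + (if k = l then 1 else 2) * ((ddF (RbB b) a k l).absHi * (Array.ofFn fun p : Fin 9 => foldW (trackW aP w) p).getD k 0 / (SC : ℤ)) * (Array.ofFn fun p : Fin 9 => foldW (trackW aP w) p).getD l 0) s) 0 else 0) := by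
    refine (hrp a.val a.isLt).trans ?_
    rw [← List.sum_toFinset _ (nearB_nodup c (trackW aP w))]
    simp only [e0, zero_add]
    refine Finset.sum_congr rfl fun b hb => ?_
    have hb' := List.mem_toFinset.1 hb
    simp only [hRpB b hb', hRbB b hb']
  have step : ∑ b ∈ (nearB c (trackW aP w)).toFinset, (if (RbB b).co.lip then 1 / 2 * ∑ k ∈ range 9, ∑ l ∈ range 9, (((ddF (RbB b) a k l).absHi : ℤ) : ℝ) / SC * (|dispN (U - cenMap c) (ξ - cenShuf c) k| * |dispN (U - cenMap c) (ξ - cenShuf c) l|) else 0) ≤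
      ∑ b ∈ (nearB c (trackW aP w)).toFinset, ((((if (RbB b).co.lip then (List.range 9).foldl (fun s k => (List.range 9).foldl (fun s2 l => if l < k then s2 else s2 + (if k = l then 1 else 2) * ((ddF (RbB b) a k l).absHi * (Array.ofFn fun p : Fin 9 => foldW (trackW aP w) p).getD k 0 / (SC : ℤ)) * (Array.ofFn fun p : Fin 9 => foldW (trackW aP w) p).getD l 0) s) 0 else 0) : ℤ) : ℝ) / (2 * (SC : ℝ) * SC) + 81 / (2 * (SC : ℝ))) := by
    refine Finset.sum_le_sum fun b hb => ?_
    split_ifs with hl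
    · exact rp_charge_le (RbB b) a (Array.ofFn fun p : Fin 9 => foldW (trackW aP w) p) hwf0 hwf1 (dispN (U - cenMap c) (ξ - cenShuf c)) hδ
    · push_cast; rw [zero_div, zero_add]; positivity
  refine step.trans (le_of_eq ?_)
  rw [Finset.sum_add_distrib, Finset.sum_const, nsmul_eq_mul, ← Finset.sum_div, List.toFinset_card_of_nodup (nearB_nodup c (trackW aP w)), erp]
  push_cast
  ring

end Summit.AtomisticToContinuum.Crystallization.Theorems.FrustratedLawDichotomyStrainedPatchHomValueT2Kit
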